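/-
Copyright (c) 2026 the pub-hodgecm-mathlib formalisation cell (harness21).  Prover seat hodgecm-mathlib-K2E2-p12 (g6): Track B «K2-LIT», ENGINE E1,
h413 = stmt-HodgeConjecture-24833; line `K2_E1_TraceFormulaBeta`, 5Res campaign «ENDGAME BY FAMILIES», ROADCARD §3′ (M2 v2, amendment #2), deal (255) of K2E1-plan (g7):
THE LETTER-FREE `hTB` AT `N = 2` (K2E4-p10's ★ A2 `cm_hTB_of_gelfand` with `θ ∕ hθmul ∕ hθη ∕ hconj` DISCHARGED by ★ p860494 ∕ p860556 ∕ p860595) and the re-issued D5′ print with only MODEL letters.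
-/
import Summits.HodgeConjecture.HodgeConjecture.Theorems.K2E1CompressionCommuteOfSphericalU                  -- ★ A2 p860650 (K2E4-p10): `cm_hTB_of_gelfand` (+ ★ A1 p860591)
import Summits.HodgeConjecture.HodgeConjecture.Theorems.K2E1IrreducibleNoContinuousSpectrumCMTwoAlgebraFree    -- ★ p860631 (this seat): `lpModel_blockProj_eq_zero_of_spherical_cm`, `indicator_…`
import Summits.HodgeConjecture.HodgeConjecture.Theorems.K2E1ArchTransposeKConjugateU2                        -- ★ p860595 (this seat): `hKconj_arch_two` (+ ★ p860556 `measurePreserving_theta_arch`, ★ p860494 `exists_transposeHomeomorph_arch`, `theta_mul_rev`)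
import HarnessLib

/-!
# K2·E1 — `K2E1BlockHeckeTBLetterFreeCMTwo` (deal (255)): THE COMPRESSION LETTER `hTB` IS A THEOREM AT `U(J₂)(𝔸_{L⁺})` (`N = 2`, CM `L`, `K_∞ = U(J₂)(L⁺⊗ℝ) ∩ U(2)`), AND ★ D5′
# «AN IRREDUCIBLE SUMMAND HAS NO CONTINUOUS SPECTRUM AT THE BLOCK `P = P_χ ∘ R_f(e)`» NOW CARRIES ONLY THE MODEL LETTERS `U s hs hU hline` (+ the block-projector ∕ sphericity data)

Track B ∕ K2-LIT, crux h413 = `stmt-HodgeConjecture-24833`, route of record `HCCMUnconditional`; cell `hodgecm-mathlib`, squad K2, ENGINE E1 (5Res campaign, M2 v2 §3′.1 (ii′)(iii′),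
N = 2 endgame path).  THEOREMS ONLY (no `def`, no `instance`, no notation, no named-fact hypothesis, no `sorry`; default heartbeats); lane `--supports stmt-HodgeConjecture-24833 --as helper`
(count-neutral).  CLOSES NO SOCKET.
THE SETTING (`N = 2`): `L` CM, `c` = complex conjugation (★ `IsCMField.complexConj_ne_one`, ★ `complexConj_smul_infinitePlace`, ★ `IsCMField.complexConj_apply_apply`), `J : Matrix (Fin 2) (Fin 2) L`
with `c`-fixed entries, `J² = 1` and `σ_w(J) = [[0,1],[1,0]]` at every complex place (Mok's `J₂`: ★ p860595 `antidiagonal_two_over_map_embedding ∕ _map ∕ _mul_self`); the compact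
`K_∞ := arch ⊓ U(1 ⊗ 1)` — the unitary points of `U(J)(L⁺ ⊗ ℝ)`, a Subgroup term, COMPACT (`isCompact_archUnitaryPoints`: closed in the compact `U(1_2)(L⁺⊗ℝ)`, ★ `isCompact_arch`) — with
`κ := Subgroup.inclusion inf_le_left`, a probability Haar measure `μ` on it and a multiplicative `χ ∈ C_c(K_∞)`; `ν_∞` an inversion-invariant Haar measure on `arch`, `ν_f` left-invariant.
* §1 `isCompact_archUnitaryPoints`, `compactSpace_archUnitaryPoints` — `K_∞` is compact.
* §2 **`cm_hTB_letterFree_two`** — ★ A2 `cm_hTB_of_gelfand` (K2E4-p10) with its four Gelfand letters DISCHARGED: `θ` := the transpose (★ `exists_transposeHomeomorph_arch`), `hθmul` (★ `theta_mul_rev`),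
  `hθη` (★ `measurePreserving_theta_arch`), `hconj` (★ `hKconj_arch_two`).  Output = ★ p860487's binder `hTB` verbatim for `T_j = R_∞(h_j) ∘L R_f(e)`, `h_j` `χ`-spherical.
* §3 **`lpModel_blockProj_eq_zero_letterFree_two`** ∕ **`indicator_lpSMul_blockProj_eq_zero_letterFree_two`** — ★ p860631 re-issued with `hTB` gone: for every unitary strongly continuous `π`
  of `U(J)(𝔸_{L⁺})` (E1: `R` on `L²` ∕ `(L²_cusp)ᗮ`), every irreducible closed `W ≤ V`, `w ∈ W`: `U (P w) = 0` (resp. `𝟙_Λ • U (P w) = 0`) GIVEN ONLY the model `U`, symbols `s_j` (`hs`), the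
  intertwining `hU` on `V_P`, the line letter `hline`, and the data (`μ, χ, e, U₀, h_j`).
HONEST LABEL: HC_CM is proved only modulo the 7 printed citations (2 remaining named inputs: hLiu418 = `stmt-HodgeConjecture-24832`, h413 = `stmt-HodgeConjecture-24833`) until rung 0
closes; this file asserts no named fact, is conditional by construction on the visible MODEL letters, and closes no socket; count-neutral.

## References
* [MoeglinWaldspurger1995] C. Mœglin, J.-L. Waldspurger, *Spectral decomposition and Eisenstein series* (1995), IV.3.12 (b), VI.2.
* [Helgason2000] S. Helgason, *Groups and Geometric Analysis* (AMS 2000): Ch. IV §3, Thm. 3.1.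
* [Knapp1986] A. W. Knapp, *Representation Theory of Semisimple Groups* (1986), VIII §3.
* [PlatonovRapinchuk1994] V. Platonov, A. Rapinchuk, *Algebraic Groups and Number Theory* (1994), §3.2 Thm. 3.1 (compactness of anisotropic real points).
-/

set_option autoImplicit false
set_option linter.dupNamespace false -- the mandated namespace repeats `HodgeConjecture.HodgeConjecture`

noncomputable section

open MeasureTheory MeasureTheory.Measure Filter Topology CompactlySupported NumberField NumberField.mixedEmbedding NumberField.InfinitePlace ContRepresentation Set
open scoped InnerProductSpace ENNReal ComplexConjugate Matrix ComplexOrder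
open Literature.NumberTheory.Automorphic Literature.NumberTheory.Automorphic.UnitaryGroup AdelicGroupData
open Summit.HodgeConjecture.HodgeConjecture.Cruxes.H413.K2E1CompressionCommuteOfSphericalU (cm_hTB_of_gelfand)
open Summit.HodgeConjecture.HodgeConjecture.Cruxes.H413.K2E1IrreducibleNoContinuousSpectrumCMTwoAlgebraFree (lpModel_blockProj_eq_zero_of_spherical_cm indicator_lpSMul_blockProj_eq_zero_of_spherical_cm)
open Summit.HodgeConjecture.HodgeConjecture.Cruxes.H413.K2E1ArchTransposeAntiAutU (exists_transposeHomeomorph_arch theta_mul_rev)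
open Summit.HodgeConjecture.HodgeConjecture.Cruxes.H413.K2E1AntiAutHaarPreservingU (measurePreserving_theta_arch)
open Summit.HodgeConjecture.HodgeConjecture.Cruxes.H413.K2E1ArchTransposeKConjugateU2 (hKconj_arch_two)

namespace Summit.HodgeConjecture.HodgeConjecture.Cruxes.H413.K2E1BlockHeckeTBLetterFreeCMTwo

variable {L : Type} [Field L] [NumberField L] [IsCMField L] (J : Matrix (Fin 2) (Fin 2) L)

/-! ## §1 The unitary points `K_∞ = U(J)(L⁺ ⊗ ℝ) ∩ U(2)` are compact -/

/-- **`K_∞ = arch ⊓ U(1 ⊗ 1)` IS COMPACT**: `U(1_2)(L⁺ ⊗ ℝ) = ∏_w U(2)` is compact (★ `isCompact_arch`, definite form `1`; every infinite place of the CM field `L` is fixed by `c ≠ 1`) and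
`U(J)(L⁺ ⊗ ℝ)` is closed (★ `isClosed_arch`). [cite: PlatonovRapinchuk1994, §3.2 Thm 3.1] -/
theorem isCompact_archUnitaryPoints :
    IsCompact ((UnitaryGroup.arch (↥(maximalRealSubfield L)) L (IsCMField.complexConj L) 2 J ⊓ unitaryGroupOfForm (conjMixed (↥(maximalRealSubfield L)) L (IsCMField.complexConj L)) 1 :
      Subgroup (GL (Fin 2) (mixedSpace L))) : Set (GL (Fin 2) (mixedSpace L))) := by
  have h1 : unitaryGroupOfForm (conjMixed (↥(maximalRealSubfield L)) L (IsCMField.complexConj L)) (1 : Matrix (Fin 2) (Fin 2) (mixedSpace L)) =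
      UnitaryGroup.arch (↥(maximalRealSubfield L)) L (IsCMField.complexConj L) 2 (1 : Matrix (Fin 2) (Fin 2) L) := by
    change _ = unitaryGroupOfForm _ (archFormOf L 2 (1 : Matrix (Fin 2) (Fin 2) L))
    rw [show archFormOf L 2 (1 : Matrix (Fin 2) (Fin 2) L) = 1 from Matrix.map_one _ (map_zero _) (map_one _)]
  have hK1 : IsCompact ((UnitaryGroup.arch (↥(maximalRealSubfield L)) L (IsCMField.complexConj L) 2 (1 : Matrix (Fin 2) (Fin 2) L) :
      Subgroup (GL (Fin 2) (mixedSpace L))) : Set (GL (Fin 2) (mixedSpace L))) :=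
    isCompact_arch (↥(maximalRealSubfield L)) L (IsCMField.complexConj L) 2 (1 : Matrix (Fin 2) (Fin 2) L) (IsCMField.complexConj_ne_one L)
      (complexConj_smul_infinitePlace L) fun w => Or.inl (by rw [Matrix.map_one _ (map_zero _) (map_one _)]; exact Matrix.PosDef.one)
  rw [Subgroup.coe_inf, h1]
  exact hK1.inter_left (isClosed_arch (↥(maximalRealSubfield L)) L (IsCMField.complexConj L) 2 J)

/-- `K_∞` as a compact space. [cite: PlatonovRapinchuk1994, §3.2 Thm 3.1] -/
theorem compactSpace_archUnitaryPoints : CompactSpace ↥(UnitaryGroup.arch (↥(maximalRealSubfield L)) L (IsCMField.complexConj L) 2 J ⊓ unitaryGroupOfForm (conjMixed (↥(maximalRealSubfield L)) L (IsCMField.complexConj L)) 1) :=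
  isCompact_iff_compactSpace.mp (isCompact_archUnitaryPoints J)

/-! ## §2 The letter-free `hTB` at `N = 2` -/

variable {V : Type*} [NormedAddCommGroup V] [InnerProductSpace ℂ V] [CompleteSpace V]
  (π : ContRepresentation ℂ (cmDatum L 2 J).Adelic V) (hu : π.IsUnitary) (hc : π.IsStronglyContinuous)
  [MeasurableSpace (UnitaryGroup.arch (↥(maximalRealSubfield L)) L (IsCMField.complexConj L) 2 J)] [BorelSpace (UnitaryGroup.arch (↥(maximalRealSubfield L)) L (IsCMField.complexConj L) 2 J)]
  [MeasurableSpace (finAdelic (↥(maximalRealSubfield L)) L (IsCMField.complexConj L) 2 J)] [BorelSpace (finAdelic (↥(maximalRealSubfield L)) L (IsCMField.complexConj L) 2 J)]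
  (νinf : Measure (UnitaryGroup.arch (↥(maximalRealSubfield L)) L (IsCMField.complexConj L) 2 J)) [IsHaarMeasure νinf] [νinf.IsInvInvariant] [SFinite νinf]
  (νf : Measure (finAdelic (↥(maximalRealSubfield L)) L (IsCMField.complexConj L) 2 J)) [IsFiniteMeasureOnCompacts νf] [νf.IsMulLeftInvariant]
  [MeasurableSpace ↥(UnitaryGroup.arch (↥(maximalRealSubfield L)) L (IsCMField.complexConj L) 2 J ⊓ unitaryGroupOfForm (conjMixed (↥(maximalRealSubfield L)) L (IsCMField.complexConj L)) 1)] [BorelSpace ↥(UnitaryGroup.arch (↥(maximalRealSubfield L)) L (IsCMField.complexConj L) 2 J ⊓ unitaryGroupOfForm (conjMixed (↥(maximalRealSubfield L)) L (IsCMField.complexConj L)) 1)]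
  (μ : Measure ↥(UnitaryGroup.arch (↥(maximalRealSubfield L)) L (IsCMField.complexConj L) 2 J ⊓ unitaryGroupOfForm (conjMixed (↥(maximalRealSubfield L)) L (IsCMField.complexConj L)) 1)) [IsProbabilityMeasure μ] [μ.IsMulLeftInvariant] [μ.IsMulRightInvariant]
  (χ : C_c(↥(UnitaryGroup.arch (↥(maximalRealSubfield L)) L (IsCMField.complexConj L) 2 J ⊓ unitaryGroupOfForm (conjMixed (↥(maximalRealSubfield L)) L (IsCMField.complexConj L)) 1), ℂ)) (e : C_c(finAdelic (↥(maximalRealSubfield L)) L (IsCMField.complexConj L) 2 J, ℂ)) {J' : Type*}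

/-- **THE LETTER-FREE `hTB` AT `N = 2`**: for `χ`-spherical `h_j` (w.r.t. `K_∞ = arch ⊓ U(1⊗1)`, `κ = Subgroup.inclusion inf_le_left`), the Hecke operators `T_j = R_∞(h_j) ∘L R_f(e)` commute on
`V_P = {P v = v}` with the compressions of the pure tensors: `P (A (T_j x)) = T_j (P (A x))` — ★ A2 `cm_hTB_of_gelfand` (K2E4-p10) with `θ = ᵀ` (★ `exists_transposeHomeomorph_arch`),
`hθmul` (★ `theta_mul_rev`), `hθη` (★ `measurePreserving_theta_arch`) and `hconj` (★ `hKconj_arch_two`) DISCHARGED. [cite: Helgason2000, Ch. IV §3 Thm. 3.1] [cite: Knapp1986, VIII §3] -/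
theorem cm_hTB_letterFree_two (hJc : J.map (IsCMField.complexConj L : L → L) = J) (hJ2 : J * J = 1)
    (hJw : ∀ w : {w : InfinitePlace L // IsComplex w}, J.map w.1.embedding = !![(0 : ℂ), 1; 1, 0])
    (hχmul : ∀ k l, χ (k * l) = χ k * χ l) (hχone : χ 1 = 1)
    (U₀ : Subgroup (finAdelic (↥(maximalRealSubfield L)) L (IsCMField.complexConj L) 2 J)) (he0 : ∀ x, x ∉ U₀ → e x = 0) (he1 : ∫ x, e x ∂νf = 1) (heK : ∀ k ∈ U₀, ∀ x, e (k * x) = e x)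
    (P : V →L[ℂ] V) (hPdef : P = ((π.restrict ((archToAdelic (↥(maximalRealSubfield L)) L (IsCMField.complexConj L) 2 J).comp (Subgroup.inclusion (inf_le_left : UnitaryGroup.arch (↥(maximalRealSubfield L)) L (IsCMField.complexConj L) 2 J ⊓ unitaryGroupOfForm (conjMixed (↥(maximalRealSubfield L)) L (IsCMField.complexConj L)) 1 ≤ UnitaryGroup.arch (↥(maximalRealSubfield L)) L (IsCMField.complexConj L) 2 J)))).integratedOperator (hu.restrict _)
          (hc.restrict _ ((continuous_archToAdelic (↥(maximalRealSubfield L)) L (IsCMField.complexConj L) 2 J).comp (continuous_induced_rng.2 continuous_subtype_val))) μ χ ∘L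
        (π.restrict (finAdelicToAdelic (↥(maximalRealSubfield L)) L (IsCMField.complexConj L) 2 J)).integratedOperator (hu.restrict _) (hc.restrict _ (continuous_finAdelicToAdelic (↥(maximalRealSubfield L)) L (IsCMField.complexConj L) 2 J)) νf e))
    (h : J' → C_c(UnitaryGroup.arch (↥(maximalRealSubfield L)) L (IsCMField.complexConj L) 2 J, ℂ))
    (hhl : ∀ (j : J') (k : ↥(UnitaryGroup.arch (↥(maximalRealSubfield L)) L (IsCMField.complexConj L) 2 J ⊓ unitaryGroupOfForm (conjMixed (↥(maximalRealSubfield L)) L (IsCMField.complexConj L)) 1)) (x : UnitaryGroup.arch (↥(maximalRealSubfield L)) L (IsCMField.complexConj L) 2 J), h j ((Subgroup.inclusion (inf_le_left : UnitaryGroup.arch (↥(maximalRealSubfield L)) L (IsCMField.complexConj L) 2 J ⊓ unitaryGroupOfForm (conjMixed (↥(maximalRealSubfield L)) L (IsCMField.complexConj L)) 1 ≤ UnitaryGroup.arch (↥(maximalRealSubfield L)) L (IsCMField.complexConj L) 2 J)) k * x) = χ k * h j x)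
    (hhr : ∀ (j : J') (k : ↥(UnitaryGroup.arch (↥(maximalRealSubfield L)) L (IsCMField.complexConj L) 2 J ⊓ unitaryGroupOfForm (conjMixed (↥(maximalRealSubfield L)) L (IsCMField.complexConj L)) 1)) (x : UnitaryGroup.arch (↥(maximalRealSubfield L)) L (IsCMField.complexConj L) 2 J), h j (x * (Subgroup.inclusion (inf_le_left : UnitaryGroup.arch (↥(maximalRealSubfield L)) L (IsCMField.complexConj L) 2 J ⊓ unitaryGroupOfForm (conjMixed (↥(maximalRealSubfield L)) L (IsCMField.complexConj L)) 1 ≤ UnitaryGroup.arch (↥(maximalRealSubfield L)) L (IsCMField.complexConj L) 2 J)) k) = χ k * h j x)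
    (T : J' → V →L[ℂ] V) (hTdef : ∀ j, T j = ((π.restrict (archToAdelic (↥(maximalRealSubfield L)) L (IsCMField.complexConj L) 2 J)).integratedOperator (hu.restrict _) (hc.restrict _ (continuous_archToAdelic (↥(maximalRealSubfield L)) L (IsCMField.complexConj L) 2 J)) νinf (h j) ∘L (π.restrict (finAdelicToAdelic (↥(maximalRealSubfield L)) L (IsCMField.complexConj L) 2 J)).integratedOperator (hu.restrict _) (hc.restrict _ (continuous_finAdelicToAdelic (↥(maximalRealSubfield L)) L (IsCMField.complexConj L) 2 J)) νf e)) :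
    ∀ j, ∀ A ∈ {A : V →L[ℂ] V | ∃ (a : C_c(UnitaryGroup.arch (↥(maximalRealSubfield L)) L (IsCMField.complexConj L) 2 J, ℂ)) (b : C_c(finAdelic (↥(maximalRealSubfield L)) L (IsCMField.complexConj L) 2 J, ℂ)),
      A = (π.restrict (archToAdelic (↥(maximalRealSubfield L)) L (IsCMField.complexConj L) 2 J)).integratedOperator (hu.restrict _) (hc.restrict _ (continuous_archToAdelic (↥(maximalRealSubfield L)) L (IsCMField.complexConj L) 2 J)) νinf a ∘L
          (π.restrict (finAdelicToAdelic (↥(maximalRealSubfield L)) L (IsCMField.complexConj L) 2 J)).integratedOperator (hu.restrict _) (hc.restrict _ (continuous_finAdelicToAdelic (↥(maximalRealSubfield L)) L (IsCMField.complexConj L) 2 J)) νf b},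
      ∀ x ∈ LinearMap.eqLocus (P : V →ₗ[ℂ] V) LinearMap.id, P (A (T j x)) = T j (P (A x)) := by
  haveI : CompactSpace ↥(UnitaryGroup.arch (↥(maximalRealSubfield L)) L (IsCMField.complexConj L) 2 J ⊓ unitaryGroupOfForm (conjMixed (↥(maximalRealSubfield L)) L (IsCMField.complexConj L)) 1) := compactSpace_archUnitaryPoints J
  haveI : νinf.IsMulRightInvariant := by
    have hinv : νinf.inv.IsMulRightInvariant := inferInstance
    rwa [Measure.inv_eq_self] at hinv
  obtain ⟨θ, hθT⟩ := exists_transposeHomeomorph_arch (↥(maximalRealSubfield L)) L (IsCMField.complexConj L) 2 J (IsCMField.complexConj_apply_apply L) hJc hJ2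
  exact cm_hTB_of_gelfand π hu hc νinf νf (Subgroup.inclusion (inf_le_left : UnitaryGroup.arch (↥(maximalRealSubfield L)) L (IsCMField.complexConj L) 2 J ⊓ unitaryGroupOfForm (conjMixed (↥(maximalRealSubfield L)) L (IsCMField.complexConj L)) 1 ≤ UnitaryGroup.arch (↥(maximalRealSubfield L)) L (IsCMField.complexConj L) 2 J)) (continuous_induced_rng.2 continuous_subtype_val) μ χ e hχmul hχone U₀ he0 he1 heK P hPdef
    θ (theta_mul_rev θ hθT) (measurePreserving_theta_arch (↥(maximalRealSubfield L)) L (IsCMField.complexConj L) 2 J θ hθT νinf)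
    (hKconj_arch_two (↥(maximalRealSubfield L)) L (IsCMField.complexConj L) J (IsCMField.complexConj_ne_one L) (complexConj_smul_infinitePlace L) hJw θ hθT) h hhl hhr T hTdef

/-! ## §3 ★ D5′ at `U(J₂)(𝔸_{L⁺})` with ONLY the model letters -/

/-- **`U (P w) = 0` — ★ D5′ WITH ONLY THE MODEL LETTERS** (`N = 2`): for every irreducible closed `W ≤ V` and `w ∈ W`, the line coordinate of the model of `P w` vanishes, GIVEN ONLY the model map
`U`, symbols `s_j` (`hs`), the intertwining `hU : U (T_j v) = s_j • U v` on `V_P` and `hline : m {∀ j, s_j = c_j} = 0` (+ the data `μ χ e U₀ h_j` with `χ* = χ`, `e* = e`, `h_j` `χ`-spherical, `ν_f`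
inversion-invariant and positive on opens, `ν_∞` positive on opens).  ★ p860631 + §2. [cite: MoeglinWaldspurger1995, IV.3.12, VI.2] [cite: Knapp1986, VIII §3] -/
theorem lpModel_blockProj_eq_zero_letterFree_two [νf.IsInvInvariant] [νf.IsOpenPosMeasure] [μ.IsInvInvariant]
    {Ω : Type*} {mΩ : MeasurableSpace Ω} {m : Measure Ω} {E : Type*} [NormedAddCommGroup E] [NormedSpace ℂ E] [Countable J'] [ENNReal.HolderTriple ∞ 2 2]
    (hJc : J.map (IsCMField.complexConj L : L → L) = J) (hJ2 : J * J = 1)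
    (hJw : ∀ w : {w : InfinitePlace L // IsComplex w}, J.map w.1.embedding = !![(0 : ℂ), 1; 1, 0])
    (hχmul : ∀ k l, χ (k * l) = χ k * χ l) (hχone : χ 1 = 1) (hχinv : ∀ k, conj (χ k⁻¹) = χ k)
    (U₀ : Subgroup (finAdelic (↥(maximalRealSubfield L)) L (IsCMField.complexConj L) 2 J)) (he0 : ∀ x, x ∉ U₀ → e x = 0) (he1 : ∫ x, e x ∂νf = 1) (heK : ∀ k ∈ U₀, ∀ x, e (k * x) = e x)
    (hestar : ∀ x, mulStar (⇑e) x = e x)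
    (P : V →L[ℂ] V) (hPdef : P = ((π.restrict ((archToAdelic (↥(maximalRealSubfield L)) L (IsCMField.complexConj L) 2 J).comp (Subgroup.inclusion (inf_le_left : UnitaryGroup.arch (↥(maximalRealSubfield L)) L (IsCMField.complexConj L) 2 J ⊓ unitaryGroupOfForm (conjMixed (↥(maximalRealSubfield L)) L (IsCMField.complexConj L)) 1 ≤ UnitaryGroup.arch (↥(maximalRealSubfield L)) L (IsCMField.complexConj L) 2 J)))).integratedOperator (hu.restrict _)
          (hc.restrict _ ((continuous_archToAdelic (↥(maximalRealSubfield L)) L (IsCMField.complexConj L) 2 J).comp (continuous_induced_rng.2 continuous_subtype_val))) μ χ ∘L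
        (π.restrict (finAdelicToAdelic (↥(maximalRealSubfield L)) L (IsCMField.complexConj L) 2 J)).integratedOperator (hu.restrict _) (hc.restrict _ (continuous_finAdelicToAdelic (↥(maximalRealSubfield L)) L (IsCMField.complexConj L) 2 J)) νf e))
    (W : ClosedSubrep π) (hW : W.toContRep.IsTopIrreducible)
    (h : J' → C_c(UnitaryGroup.arch (↥(maximalRealSubfield L)) L (IsCMField.complexConj L) 2 J, ℂ))
    (hhl : ∀ (j : J') (k : ↥(UnitaryGroup.arch (↥(maximalRealSubfield L)) L (IsCMField.complexConj L) 2 J ⊓ unitaryGroupOfForm (conjMixed (↥(maximalRealSubfield L)) L (IsCMField.complexConj L)) 1)) (x : UnitaryGroup.arch (↥(maximalRealSubfield L)) L (IsCMField.complexConj L) 2 J), h j ((Subgroup.inclusion (inf_le_left : UnitaryGroup.arch (↥(maximalRealSubfield L)) L (IsCMField.complexConj L) 2 J ⊓ unitaryGroupOfForm (conjMixed (↥(maximalRealSubfield L)) L (IsCMField.complexConj L)) 1 ≤ UnitaryGroup.arch (↥(maximalRealSubfield L)) L (IsCMField.complexConj L) 2 J)) k * x) = χ k * h j x)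
    (hhr : ∀ (j : J') (k : ↥(UnitaryGroup.arch (↥(maximalRealSubfield L)) L (IsCMField.complexConj L) 2 J ⊓ unitaryGroupOfForm (conjMixed (↥(maximalRealSubfield L)) L (IsCMField.complexConj L)) 1)) (x : UnitaryGroup.arch (↥(maximalRealSubfield L)) L (IsCMField.complexConj L) 2 J), h j (x * (Subgroup.inclusion (inf_le_left : UnitaryGroup.arch (↥(maximalRealSubfield L)) L (IsCMField.complexConj L) 2 J ⊓ unitaryGroupOfForm (conjMixed (↥(maximalRealSubfield L)) L (IsCMField.complexConj L)) 1 ≤ UnitaryGroup.arch (↥(maximalRealSubfield L)) L (IsCMField.complexConj L) 2 J)) k) = χ k * h j x)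
    (U : V →ₗ[ℂ] Lp E 2 m) (s : J' → Ω → ℂ) (hs : ∀ j, MemLp (s j) ∞ m)
    (hU : ∀ j, ∀ v ∈ LinearMap.eqLocus (P : V →ₗ[ℂ] V) LinearMap.id, U (((π.restrict (archToAdelic (↥(maximalRealSubfield L)) L (IsCMField.complexConj L) 2 J)).integratedOperator (hu.restrict _) (hc.restrict _ (continuous_archToAdelic (↥(maximalRealSubfield L)) L (IsCMField.complexConj L) 2 J)) νinf (h j) ∘L (π.restrict (finAdelicToAdelic (↥(maximalRealSubfield L)) L (IsCMField.complexConj L) 2 J)).integratedOperator (hu.restrict _) (hc.restrict _ (continuous_finAdelicToAdelic (↥(maximalRealSubfield L)) L (IsCMField.complexConj L) 2 J)) νf e) v) = (hs j).toLp (s j) • U v)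
    (hline : ∀ c : J' → ℂ, m {x | ∀ j, s j x = c j} = 0) {w : V} (hw : w ∈ W) :
    U (P w) = 0 :=
  lpModel_blockProj_eq_zero_of_spherical_cm π hu hc νinf νf (Subgroup.inclusion (inf_le_left : UnitaryGroup.arch (↥(maximalRealSubfield L)) L (IsCMField.complexConj L) 2 J ⊓ unitaryGroupOfForm (conjMixed (↥(maximalRealSubfield L)) L (IsCMField.complexConj L)) 1 ≤ UnitaryGroup.arch (↥(maximalRealSubfield L)) L (IsCMField.complexConj L) 2 J)) (continuous_induced_rng.2 continuous_subtype_val) μ χ e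
    hχmul hχone hχinv U₀ he0 he1 heK hestar P hPdef W hW h hhl hhr
    (cm_hTB_letterFree_two J π hu hc νinf νf μ χ e hJc hJ2 hJw hχmul hχone U₀ he0 he1 heK P hPdef h hhl hhr (fun j => ((π.restrict (archToAdelic (↥(maximalRealSubfield L)) L (IsCMField.complexConj L) 2 J)).integratedOperator (hu.restrict _) (hc.restrict _ (continuous_archToAdelic (↥(maximalRealSubfield L)) L (IsCMField.complexConj L) 2 J)) νinf (h j) ∘L (π.restrict (finAdelicToAdelic (↥(maximalRealSubfield L)) L (IsCMField.complexConj L) 2 J)).integratedOperator (hu.restrict _) (hc.restrict _ (continuous_finAdelicToAdelic (↥(maximalRealSubfield L)) L (IsCMField.complexConj L) 2 J)) νf e)) (fun _ => rfl))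
    U s hs hU hline hw

/-- **`𝟙_Λ • U (P w) = 0` — the general line-part form** of the same, only MODEL letters. [cite: MoeglinWaldspurger1995, IV.3.12, VI.2] -/
theorem indicator_lpSMul_blockProj_eq_zero_letterFree_two [νf.IsInvInvariant] [νf.IsOpenPosMeasure] [μ.IsInvInvariant]
    {Ω : Type*} {mΩ : MeasurableSpace Ω} {m : Measure Ω} {E : Type*} [NormedAddCommGroup E] [NormedSpace ℂ E] [Countable J'] [ENNReal.HolderTriple ∞ 2 2]
    (hJc : J.map (IsCMField.complexConj L : L → L) = J) (hJ2 : J * J = 1)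
    (hJw : ∀ w : {w : InfinitePlace L // IsComplex w}, J.map w.1.embedding = !![(0 : ℂ), 1; 1, 0])
    (hχmul : ∀ k l, χ (k * l) = χ k * χ l) (hχone : χ 1 = 1) (hχinv : ∀ k, conj (χ k⁻¹) = χ k)
    (U₀ : Subgroup (finAdelic (↥(maximalRealSubfield L)) L (IsCMField.complexConj L) 2 J)) (he0 : ∀ x, x ∉ U₀ → e x = 0) (he1 : ∫ x, e x ∂νf = 1) (heK : ∀ k ∈ U₀, ∀ x, e (k * x) = e x)
    (hestar : ∀ x, mulStar (⇑e) x = e x)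
    (P : V →L[ℂ] V) (hPdef : P = ((π.restrict ((archToAdelic (↥(maximalRealSubfield L)) L (IsCMField.complexConj L) 2 J).comp (Subgroup.inclusion (inf_le_left : UnitaryGroup.arch (↥(maximalRealSubfield L)) L (IsCMField.complexConj L) 2 J ⊓ unitaryGroupOfForm (conjMixed (↥(maximalRealSubfield L)) L (IsCMField.complexConj L)) 1 ≤ UnitaryGroup.arch (↥(maximalRealSubfield L)) L (IsCMField.complexConj L) 2 J)))).integratedOperator (hu.restrict _)
          (hc.restrict _ ((continuous_archToAdelic (↥(maximalRealSubfield L)) L (IsCMField.complexConj L) 2 J).comp (continuous_induced_rng.2 continuous_subtype_val))) μ χ ∘L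
        (π.restrict (finAdelicToAdelic (↥(maximalRealSubfield L)) L (IsCMField.complexConj L) 2 J)).integratedOperator (hu.restrict _) (hc.restrict _ (continuous_finAdelicToAdelic (↥(maximalRealSubfield L)) L (IsCMField.complexConj L) 2 J)) νf e))
    (W : ClosedSubrep π) (hW : W.toContRep.IsTopIrreducible)
    (h : J' → C_c(UnitaryGroup.arch (↥(maximalRealSubfield L)) L (IsCMField.complexConj L) 2 J, ℂ))
    (hhl : ∀ (j : J') (k : ↥(UnitaryGroup.arch (↥(maximalRealSubfield L)) L (IsCMField.complexConj L) 2 J ⊓ unitaryGroupOfForm (conjMixed (↥(maximalRealSubfield L)) L (IsCMField.complexConj L)) 1)) (x : UnitaryGroup.arch (↥(maximalRealSubfield L)) L (IsCMField.complexConj L) 2 J), h j ((Subgroup.inclusion (inf_le_left : UnitaryGroup.arch (↥(maximalRealSubfield L)) L (IsCMField.complexConj L) 2 J ⊓ unitaryGroupOfForm (conjMixed (↥(maximalRealSubfield L)) L (IsCMField.complexConj L)) 1 ≤ UnitaryGroup.arch (↥(maximalRealSubfield L)) L (IsCMField.complexConj L) 2 J)) k * x) = χ k * h j x)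
    (hhr : ∀ (j : J') (k : ↥(UnitaryGroup.arch (↥(maximalRealSubfield L)) L (IsCMField.complexConj L) 2 J ⊓ unitaryGroupOfForm (conjMixed (↥(maximalRealSubfield L)) L (IsCMField.complexConj L)) 1)) (x : UnitaryGroup.arch (↥(maximalRealSubfield L)) L (IsCMField.complexConj L) 2 J), h j (x * (Subgroup.inclusion (inf_le_left : UnitaryGroup.arch (↥(maximalRealSubfield L)) L (IsCMField.complexConj L) 2 J ⊓ unitaryGroupOfForm (conjMixed (↥(maximalRealSubfield L)) L (IsCMField.complexConj L)) 1 ≤ UnitaryGroup.arch (↥(maximalRealSubfield L)) L (IsCMField.complexConj L) 2 J)) k) = χ k * h j x)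
    (U : V →ₗ[ℂ] Lp E 2 m) (s : J' → Ω → ℂ) (hs : ∀ j, MemLp (s j) ∞ m)
    (hU : ∀ j, ∀ v ∈ LinearMap.eqLocus (P : V →ₗ[ℂ] V) LinearMap.id, U (((π.restrict (archToAdelic (↥(maximalRealSubfield L)) L (IsCMField.complexConj L) 2 J)).integratedOperator (hu.restrict _) (hc.restrict _ (continuous_archToAdelic (↥(maximalRealSubfield L)) L (IsCMField.complexConj L) 2 J)) νinf (h j) ∘L (π.restrict (finAdelicToAdelic (↥(maximalRealSubfield L)) L (IsCMField.complexConj L) 2 J)).integratedOperator (hu.restrict _) (hc.restrict _ (continuous_finAdelicToAdelic (↥(maximalRealSubfield L)) L (IsCMField.complexConj L) 2 J)) νf e) v) = (hs j).toLp (s j) • U v)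
    {Λ : Set Ω} (hΛ : MeasurableSet Λ) (hline : ∀ c : J' → ℂ, m (Λ ∩ {x | ∀ j, s j x = c j}) = 0) (hΛ1 : MemLp (Λ.indicator fun _ : Ω => (1 : ℂ)) ∞ m)
    {w : V} (hw : w ∈ W) :
    (hΛ1.toLp (Λ.indicator fun _ : Ω => (1 : ℂ)) • U (P w) : Lp E 2 m) = 0 :=
  indicator_lpSMul_blockProj_eq_zero_of_spherical_cm π hu hc νinf νf (Subgroup.inclusion (inf_le_left : UnitaryGroup.arch (↥(maximalRealSubfield L)) L (IsCMField.complexConj L) 2 J ⊓ unitaryGroupOfForm (conjMixed (↥(maximalRealSubfield L)) L (IsCMField.complexConj L)) 1 ≤ UnitaryGroup.arch (↥(maximalRealSubfield L)) L (IsCMField.complexConj L) 2 J)) (continuous_induced_rng.2 continuous_subtype_val) μ χ e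
    hχmul hχone hχinv U₀ he0 he1 heK hestar P hPdef W hW h hhl hhr
    (cm_hTB_letterFree_two J π hu hc νinf νf μ χ e hJc hJ2 hJw hχmul hχone U₀ he0 he1 heK P hPdef h hhl hhr (fun j => ((π.restrict (archToAdelic (↥(maximalRealSubfield L)) L (IsCMField.complexConj L) 2 J)).integratedOperator (hu.restrict _) (hc.restrict _ (continuous_archToAdelic (↥(maximalRealSubfield L)) L (IsCMField.complexConj L) 2 J)) νinf (h j) ∘L (π.restrict (finAdelicToAdelic (↥(maximalRealSubfield L)) L (IsCMField.complexConj L) 2 J)).integratedOperator (hu.restrict _) (hc.restrict _ (continuous_finAdelicToAdelic (↥(maximalRealSubfield L)) L (IsCMField.complexConj L) 2 J)) νf e)) (fun _ => rfl))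
    U s hs hU hΛ hline hΛ1 hw

end Summit.HodgeConjecture.HodgeConjecture.Cruxes.H413.K2E1BlockHeckeTBLetterFreeCMTwo

end
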